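import Literature.AlgebraicGeometry.Motives.IntegralModelTwoSectionFibreIdentity
import HarnessLib

/-!
# The generic two-section bridge AT ONE POINT (`hfin` ∕ `hne` asked at `x` only)
# ([SerreTate1968] §1; [EGAIV4] 17.6.1, 18.5.17; [Liu2021] proof of Cor. D.9)

`Literature/AlgebraicGeometry/Motives/IntegralModelTwoSectionFibreIdentityAt.lean`, namespace
`Literature.AlgebraicGeometry.Motives.IntegralModel`.  THEOREMS only (no definition, no instance, no notation, no named fact, no `sorry`).
Cell `hodgecm-mathlib` (D-0151), FLOOR 0, programme F0P5a (D9op road 2′, crux item stmt-HodgeConjecture-24832; line `F0_D9opRoad2`,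
ED. 5 desk section `PenLemmas` §1b by F0P5a-p01 (g4), split out as a ★ leaf by F0P5a-p03 (g4) so that the line file cites it by name).

★ `IntegralModelTwoSectionFibreIdentity` §4–§5 state the two-section bridge with the `p₁`-fibres on `Ω`-points finite and non-empty at
EVERY point (`hfin`, `hne` quantified over all `x`).  The record consumer ([Liu2021] proof of Cor. D.9, p. 139 L4–L10) only knows this
AT THE POINT `x` it looks at — the full-fibre clause of the two-section datum is pointwise — and `Surjective π₁.left` is not available
there.  This leaf restates §4's bridge and §5's `Fr`-form with

* `hfin : Finite {y : T(Ω) // p₁ y = x}` and `hne : Nonempty {y : T(Ω) // p₁ y = x}` as hypotheses AT `x` ALONE,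

all other binders VERBATIM as in ★ §4–§5 (PROPER models `𝒮`, `𝒯` of `X`, `T` over `𝓞_{K,(v)}`, model morphisms `π₁ π₂ : 𝒯 ⟶ 𝒮` with
generic fibres `p₁ p₂` — C2a squares `hπ₁ hπ₂` —, `π₁` FLAT and locally of finite presentation, two maps `s s'` on `κ̄(v)`-points
exhausting the `π₁ᵥ`-fibres (`hcov`) with `s` a section (`hs`), an open `V ⊆ 𝒯ᵥ` on which `π₁ᵥ` is an open immersion and containing
`s ȳ` whenever `s ȳ ≠ s' ȳ` (`hV`); for the `Fr`-form a plain self-map `Fr` of `𝒮ᵥ(κ̄(v))` with `π₂ᵥ ∘ s = Fr` (`hs₂`) and a plain `g`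
with `Fr ∘ π₂ᵥ ∘ s' ∘ red_𝒮 = g` (`hs'₂`)).

* §1 `IntegralModel.finsum_geomReductionMap_map_eq_of_isOpenImmersion_specialFibre_at` —
  `Σ_{y over x} {red_𝒮 (p₂ y)} = {π₂ᵥ (s x̄)} + (#p₁⁻¹(x) − 1) • {π₂ᵥ (s' x̄)}`, `x̄ = red_𝒮 x`.
* §2 **`IntegralModel.finsum_map_geomReductionMap_map_eq_of_isOpenImmersion_specialFibre_at`** —
  `Σ_{y over x} {Fr (red_𝒮 (p₂ y))} = {Fr (Fr (red_𝒮 x))} + (#p₁⁻¹(x) − 1) • {g x}` (the shape the record letter consumes).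

PROOF: ★ (Γ3-A′) `IntegralModel.finsum_smul_geomReductionMap_map_eq_of_two_sections` (weights `≡ 1`, its `he`∕`hn`∕`hn1` are pointwise
already) plus ★ §3 `IntegralModel.ncard_fibre_geomReductionMap_eq_one_of_isOpenImmersion_specialFibre` for multiplicity one on the
`s`-branch; then `Multiset.map Fr`.  NOTHING of the record currency (Shimura datum, Hecke translates, Frobenius, `⟨ϖ⟩`) is used or
asserted: `Fr`, `g` are plain functions.

HC_CM is proved only modulo the 7 printed citations until rung 0 closes; this file is generic capital and changes no count.  Ours
(formalisation glue); axioms `propext`, `Classical.choice`, `Quot.sound`.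

## References
* [SerreTate1968] J.-P. Serre, J. Tate, *Good reduction of abelian varieties*, Ann. of Math. 88 (1968), §1 (the reduction map).
* [EGAIV4] A. Grothendieck, J. Dieudonné, *ÉGA IV₄*, Publ. Math. IHÉS 32 (1967), Thm. 17.6.1, Thm. 18.5.17.
* [Liu2021] Y. Liu, proof of Cor. D.9, p. 139 L4–L10 (where `n = q + 1` and the two sections are `T⁺`, `T⁻`).
-/

set_option autoImplicit false

noncomputable section

open CategoryTheory CategoryTheory.Limits AlgebraicGeometry IsDedekindDomain IsDedekindDomain.HeightOneSpectrum IsLocalRing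
open scoped NumberField
open Literature.NumberTheory.EllipticCurves (genericFibre)
open Literature.NumberTheory.DiophantineGeometry

namespace Literature.AlgebraicGeometry.Motives

namespace IntegralModel

variable {K : Type} [Field K] [NumberField K] {v : HeightOneSpectrum (𝓞 K)} {X T : SchemeOver K}

/-! ### §0 Two folklore `finsum` identities (copies of the private lemmas of ★ `IntegralModelTwoSectionPushforward` ∕
★ `IntegralModelTwoSectionFibreIdentity`) -/

/-- `∑ᶠ` of the constant `1` over a finite type is its cardinality. [folklore] -/
private theorem finsum_one_eq_natCard (α : Type*) [Finite α] : ∑ᶠ _ : α, (1 : ℕ) = Nat.card α := by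
  haveI := Fintype.ofFinite α
  rw [finsum_eq_sum_of_fintype, Finset.sum_const, Finset.card_univ, smul_eq_mul, mul_one, Nat.card_eq_fintype_card]

/-- Pushing a map `Fr` through a finite `∑ᶠ` of singletons equal to `{a} + n • {b}`. [folklore] -/
private theorem finsum_singleton_map_eq {ι β : Type*} [Finite ι] (m : ι → β) (Fr : β → β) {a b a' b' : β} {n : ℕ}
    (h : ∑ᶠ i, ({m i} : Multiset β) = {a} + n • ({b} : Multiset β)) (ha : Fr a = a') (hb : Fr b = b') :
    ∑ᶠ i, ({Fr (m i)} : Multiset β) = {a'} + n • ({b'} : Multiset β) := by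
  subst ha hb
  have hmap : Multiset.map Fr (∑ᶠ i, ({m i} : Multiset β)) = ∑ᶠ i, ({Fr (m i)} : Multiset β) := by
    rw [← Multiset.coe_mapAddMonoidHom, AddMonoidHom.map_finsum _ (Set.toFinite _)]
    simp only [Multiset.coe_mapAddMonoidHom, Multiset.map_singleton]
  rw [← hmap, h, Multiset.map_add, Multiset.map_nsmul, Multiset.map_singleton, Multiset.map_singleton]

/-! ### §1 The bridge AT ONE POINT -/

/-- **The generic two-section bridge AT ONE POINT.**  Same binders as ★
`IntegralModel.finsum_geomReductionMap_map_eq_of_isOpenImmersion_specialFibre` except that finiteness (`hfin`) and non-emptiness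
(`hne`) of the `p₁`-fibre on `Ω`-points are asked at the point `x` only: PROPER models `𝒮`, `𝒯`, model morphisms `π₁ π₂` with generic
fibres `p₁ p₂` (C2a squares), `π₁` flat and lfp, two maps `s s'` exhausting the `π₁ᵥ`-fibres with `s` a section, an open `V` on which
`π₁ᵥ` is an open immersion containing `s ȳ` whenever `s ȳ ≠ s' ȳ`.  Then
`Σ_{y over x} {red_𝒮 (p₂ y)} = {π₂ᵥ (s x̄)} + (#p₁⁻¹(x) − 1) • {π₂ᵥ (s' x̄)}`, `x̄ = red_𝒮 x`.
(★ (Γ3-A′) `finsum_smul_geomReductionMap_map_eq_of_two_sections` with weights `≡ 1`; multiplicity one on the `s`-branch from ★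
`ncard_fibre_geomReductionMap_eq_one_of_isOpenImmersion_specialFibre`.)
[cite: SerreTate1968, §1] [cite: EGAIV4, Thm. 17.6.1 and Thm. 18.5.17 (p. 134)] [cite: Liu2021, proof of Cor. D.9 p. 139 L4–L10] -/
theorem finsum_geomReductionMap_map_eq_of_isOpenImmersion_specialFibre_at
    (𝒮 : IntegralModel (valuationSubringAtPrime K v) K X) (𝒯 : IntegralModel (valuationSubringAtPrime K v) K T)
    [IsProper 𝒮.total.hom] [IsProper 𝒯.total.hom]
    (π₁ π₂ : 𝒯.total ⟶ 𝒮.total) [Flat π₁.left] [LocallyOfFinitePresentation π₁.left] (p₁ p₂ : T ⟶ X)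
    (hπ₁ : (genericFibre (valuationSubringAtPrime K v) K).map π₁ ≫ 𝒮.genericIso'.hom = 𝒯.genericIso'.hom ≫ p₁)
    (hπ₂ : (genericFibre (valuationSubringAtPrime K v) K).map π₂ ≫ 𝒮.genericIso'.hom = 𝒯.genericIso'.hom ≫ p₂)
    (s s' : AlgPoints 𝒮.reductionAt (geomResidueField v) → AlgPoints 𝒯.reductionAt (geomResidueField v))
    (hcov : ∀ (z : AlgPoints 𝒯.reductionAt (geomResidueField v)) (yb : AlgPoints 𝒮.reductionAt (geomResidueField v)),
      AlgPoints.map ((specialFibreFunctor v).map π₁) z = yb → z = s yb ∨ z = s' yb)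
    (hs : ∀ yb : AlgPoints 𝒮.reductionAt (geomResidueField v), AlgPoints.map ((specialFibreFunctor v).map π₁) (s yb) = yb)
    (V : (𝒯.reductionAt).left.Opens) [IsOpenImmersion (V.ι ≫ ((specialFibreFunctor v).map π₁).left)]
    (hV : ∀ yb : AlgPoints 𝒮.reductionAt (geomResidueField v),
      s yb ≠ s' yb → (s yb).toSpecHom.base (closedPoint (geomResidueField v)) ∈ V)
    (x : AlgPoints X (AlgebraicClosure (v.adicCompletion K)))
    (hfin : Finite {y : AlgPoints T (AlgebraicClosure (v.adicCompletion K)) // AlgPoints.map p₁ y = x})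
    (hne : Nonempty {y : AlgPoints T (AlgebraicClosure (v.adicCompletion K)) // AlgPoints.map p₁ y = x}) :
    ∑ᶠ y : {y : AlgPoints T (AlgebraicClosure (v.adicCompletion K)) // AlgPoints.map p₁ y = x},
        ({𝒮.geomReductionMap (AlgPoints.map p₂ y.1)} : Multiset (AlgPoints 𝒮.reductionAt (geomResidueField v)))
      = {AlgPoints.map ((specialFibreFunctor v).map π₂) (s (𝒮.geomReductionMap x))}
        + (Nat.card {y : AlgPoints T (AlgebraicClosure (v.adicCompletion K)) // AlgPoints.map p₁ y = x} - 1) •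
          ({AlgPoints.map ((specialFibreFunctor v).map π₂) (s' (𝒮.geomReductionMap x))} :
            Multiset (AlgPoints 𝒮.reductionAt (geomResidueField v))) := by
  have hn1 : 1 ≤ Nat.card {y : AlgPoints T (AlgebraicClosure (v.adicCompletion K)) // AlgPoints.map p₁ y = x} := Nat.card_pos
  -- weight one on the `s`-branch (★ E1a ∘ E1)
  have hone : s (𝒮.geomReductionMap x) ≠ s' (𝒮.geomReductionMap x) →
      ∑ᶠ y : {y : {y : AlgPoints T (AlgebraicClosure (v.adicCompletion K)) // AlgPoints.map p₁ y = x} //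
          𝒯.geomReductionMap y.1 = s (𝒮.geomReductionMap x)}, (fun _ => (1 : ℕ)) y.1 = 1 := by
    intro hss'
    haveI : Finite {y : {y : AlgPoints T (AlgebraicClosure (v.adicCompletion K)) // AlgPoints.map p₁ y = x} //
        𝒯.geomReductionMap y.1 = s (𝒮.geomReductionMap x)} := Subtype.finite
    rw [finsum_one_eq_natCard,
      Nat.card_congr (Equiv.subtypeSubtypeEquivSubtypeInter
        (fun y : AlgPoints T (AlgebraicClosure (v.adicCompletion K)) => AlgPoints.map p₁ y = x)
        (fun y => 𝒯.geomReductionMap y = s (𝒮.geomReductionMap x)))]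
    change Nat.card ↥({y : AlgPoints T (AlgebraicClosure (v.adicCompletion K)) |
        AlgPoints.map p₁ y = x ∧ 𝒯.geomReductionMap y = s (𝒮.geomReductionMap x)} : Set _) = 1
    rw [Nat.card_coe_set_eq]
    exact ncard_fibre_geomReductionMap_eq_one_of_isOpenImmersion_specialFibre 𝒮 𝒯 π₁ p₁ hπ₁ V x
      (s (𝒮.geomReductionMap x)) (hs _) (hV _ hss')
  have h := finsum_smul_geomReductionMap_map_eq_of_two_sections 𝒮 𝒯 π₁ π₂ p₁ p₂ hπ₁ hπ₂ x (fun _ => 1)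
    (Set.toFinite _) _ (finsum_one_eq_natCard _) hn1 s s' hcov hone
  simp_rw [one_smul] at h
  exact h

/-! ### §2 The bridge AT ONE POINT with `Fr` pushed through (the shape the record letter consumes) -/

/-- **The bridge AT ONE POINT with a self-map `Fr` of `𝒮ᵥ(κ̄)` pushed through** — the pointwise form of ★
`IntegralModel.finsum_map_geomReductionMap_map_eq_of_isOpenImmersion_specialFibre` (`hfin`, `hne` at `x` only): with `π₂ᵥ ∘ s = Fr`
on `κ̄(v)`-points (`hs₂`) and `Fr ∘ π₂ᵥ ∘ s' ∘ red_𝒮 = g` on `X(Ω)` (`hs'₂`),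
`Σ_{y over x} {Fr (red_𝒮 (p₂ y))} = {Fr (Fr (red_𝒮 x))} + (#p₁⁻¹(x) − 1) • {g x}`.  `Fr`, `g` are plain functions (in [Liu2021]
D.8 (3): the `q`-Frobenius and `red_𝒮 ∘ ⟨ϖ⟩`); nothing of that record currency is used here.
[cite: SerreTate1968, §1] [cite: EGAIV4, Thm. 17.6.1 and Thm. 18.5.17 (p. 134)]
[cite: Liu2021, Prop. D.8 (1)–(3) and proof of Cor. D.9 p. 139 L4–L10] -/
theorem finsum_map_geomReductionMap_map_eq_of_isOpenImmersion_specialFibre_at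
    (𝒮 : IntegralModel (valuationSubringAtPrime K v) K X) (𝒯 : IntegralModel (valuationSubringAtPrime K v) K T)
    [IsProper 𝒮.total.hom] [IsProper 𝒯.total.hom]
    (π₁ π₂ : 𝒯.total ⟶ 𝒮.total) [Flat π₁.left] [LocallyOfFinitePresentation π₁.left] (p₁ p₂ : T ⟶ X)
    (hπ₁ : (genericFibre (valuationSubringAtPrime K v) K).map π₁ ≫ 𝒮.genericIso'.hom = 𝒯.genericIso'.hom ≫ p₁)
    (hπ₂ : (genericFibre (valuationSubringAtPrime K v) K).map π₂ ≫ 𝒮.genericIso'.hom = 𝒯.genericIso'.hom ≫ p₂)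
    (s s' : AlgPoints 𝒮.reductionAt (geomResidueField v) → AlgPoints 𝒯.reductionAt (geomResidueField v))
    (hcov : ∀ (z : AlgPoints 𝒯.reductionAt (geomResidueField v)) (yb : AlgPoints 𝒮.reductionAt (geomResidueField v)),
      AlgPoints.map ((specialFibreFunctor v).map π₁) z = yb → z = s yb ∨ z = s' yb)
    (hs : ∀ yb : AlgPoints 𝒮.reductionAt (geomResidueField v), AlgPoints.map ((specialFibreFunctor v).map π₁) (s yb) = yb)
    (V : (𝒯.reductionAt).left.Opens) [IsOpenImmersion (V.ι ≫ ((specialFibreFunctor v).map π₁).left)]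
    (hV : ∀ yb : AlgPoints 𝒮.reductionAt (geomResidueField v),
      s yb ≠ s' yb → (s yb).toSpecHom.base (closedPoint (geomResidueField v)) ∈ V)
    (Fr : AlgPoints 𝒮.reductionAt (geomResidueField v) → AlgPoints 𝒮.reductionAt (geomResidueField v))
    (hs₂ : ∀ yb : AlgPoints 𝒮.reductionAt (geomResidueField v), AlgPoints.map ((specialFibreFunctor v).map π₂) (s yb) = Fr yb)
    (g : AlgPoints X (AlgebraicClosure (v.adicCompletion K)) → AlgPoints 𝒮.reductionAt (geomResidueField v))
    (hs'₂ : ∀ y : AlgPoints X (AlgebraicClosure (v.adicCompletion K)),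
      Fr (AlgPoints.map ((specialFibreFunctor v).map π₂) (s' (𝒮.geomReductionMap y))) = g y)
    (x : AlgPoints X (AlgebraicClosure (v.adicCompletion K)))
    (hfin : Finite {y : AlgPoints T (AlgebraicClosure (v.adicCompletion K)) // AlgPoints.map p₁ y = x})
    (hne : Nonempty {y : AlgPoints T (AlgebraicClosure (v.adicCompletion K)) // AlgPoints.map p₁ y = x}) :
    ∑ᶠ y : {y : AlgPoints T (AlgebraicClosure (v.adicCompletion K)) // AlgPoints.map p₁ y = x},
        ({Fr (𝒮.geomReductionMap (AlgPoints.map p₂ y.1))} : Multiset (AlgPoints 𝒮.reductionAt (geomResidueField v)))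
      = {Fr (Fr (𝒮.geomReductionMap x))}
        + (Nat.card {y : AlgPoints T (AlgebraicClosure (v.adicCompletion K)) // AlgPoints.map p₁ y = x} - 1) •
          ({g x} : Multiset (AlgPoints 𝒮.reductionAt (geomResidueField v))) :=
  finsum_singleton_map_eq _ Fr
    (finsum_geomReductionMap_map_eq_of_isOpenImmersion_specialFibre_at 𝒮 𝒯 π₁ π₂ p₁ p₂ hπ₁ hπ₂ s s' hcov hs V hV x hfin hne)
    (congrArg Fr (hs₂ _)) (hs'₂ x)

end IntegralModel

end Literature.AlgebraicGeometry.Motives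

end
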